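import Mathlib
import Literature.AlgebraicGeometry.Resolution.CobordantGame
import Summits.ResolutionOfSingularities.ResolutionOfSingularities.Theorems.WeightedInvariantLocalWeightedDropTerminalDoublePoints
import Summits.ResolutionOfSingularities.ResolutionOfSingularities.Theorems.WeightedInvariantLocalWeightedDropSeparableTerminalDoublePointsAux

/-!
# `WeightedInvariant.LocalWeightedDrop`, line `hasse-ridge-face-selection`: the SEPARABLE TERMINAL char-2 double points are WON

Crux item stmt-ResolutionOfSingularities-8899 `LocalWeightedDrop` (route `ResolutionOfSingularities/WeightedInvariant`), serving the
door `WeightedConstruction` stmt-ResolutionOfSingularities-0571.  [OURS · L1 W4.3, chain w43, stub worker 2 (gen 2): the proposed v22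
piece S2sT `stub_charTwoSeparableTerminalWon` BY NAME AND SIGNATURE (typed sub-cut of S2s `stub_charTwoSeparableDoublePointWon`,
evidence #56 on stmt-8899, file `S2sSubcut.lean`); replaces the role of the «monomial / small residual» terminal cases of a
surface-resolution algorithm for monic double points `y² + A₁ y + A₀`; NOT a statement of any manuscript.]

The TERMINAL separable double points over an algebraically closed field of characteristic `2` — coefficient ideal
`J₂ = (A₀, A₁²)` principal monomial or «small residual» (the printed notions of Perlega 2017 §7.3 = Hauser–Perlega 2024 §3/§8 at
`c = p = 2`, with the ord-cleanness / boundary clauses dropped):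
* (M1) `sepMonomialWon`: `A₀ = x₀^r x₁^s·U`, `U(0) ≠ 0`, `(r,s) ∉ 2ℕ²`, `A₁ = x₀^{⌊r/2⌋} x₁^{⌊s/2⌋}·B` — induction on `r + s` along
  the curve steps `V(x_i, y)` (`SepTerminalDoublePoint.won_dp1_of_curveStep`; the `x_i`-multiplicity of `A₁` drops by one,
  `⌊(r+2)/2⌋ = ⌊r/2⌋ + 1`), bottom `(1,1)` = the cross term `x₀x₁` (`won_dp1_of_coeff_cross_A₀_ne_zero`), `(1,0)/(0,1)` non-singular;
* (M2) `sepSheetsWon`: `A₁ = x₀^r x₁^s·V`, `V(0) ≠ 0`, `A₀ = x₀^{2r} x₁^{2s}·W` (two smooth sheets) — induction on `r + s`, bottom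
  `r + s = 1` = the cross term `V(0)·x_i y`, `r + s = 0` non-singular;
* (SR) `sepSmallResidualWon`: `A₀ = x_i^{2m}·g`, `ord g = 1`, `A₁ = x_i^m·B`, `m ≥ 1` — induction on `m`, at the last step the slice
  `y² + c² g(ρ_i) + …` has a linear term.
At every step a position whose `A₁` has a non-zero LINEAR coefficient is won outright (`won_dp1_of_coeff_single_A₁_ne_zero`: the cross
term `x_l·y`; in characteristic `2` a square of a linear form has no cross terms), and a position with `A₁(0) ≠ 0` is not singular; this
is the only use of `char k = 2` and `k = k̄` (through `stub_coneDichotomy`).  Only the singular germs in ONE variable are assumed won.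
`stub_charTwoSeparableTerminalWon` is the verbatim corollary (its hypotheses `ord A₀ ≥ 3`, `ord A₁ ≥ 2`, `A₁ ≠ 0` and the
two-variable germs are idle).
-/

set_option linter.dupNamespace false -- mandated namespace of this single-conjunct summit

namespace Summit.ResolutionOfSingularities.ResolutionOfSingularities.Theorems

open Literature.AlgebraicGeometry.Resolution
open Literature.AlgebraicGeometry.Resolution.CobordantGame

namespace SepTerminalDoublePoint

open MvPowerSeries TerminalDoublePoint

variable {k : Type} [Field k]

/-- The constant coefficient of `x₀^a x₁^b · W` vanishes as soon as `a + b ≥ 1`. -/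
theorem constantCoeff_monomial_mul_eq_zero {a b : ℕ} (hab : 1 ≤ a + b) (W : MvPowerSeries (Fin 2) k) :
    constantCoeff (X 0 ^ a * X 1 ^ b * W) = 0 := by
  rw [map_mul, map_mul, map_pow, map_pow, constantCoeff_X, constantCoeff_X]
  rcases Nat.eq_zero_or_pos a with rfl | ha
  · have hb : b ≠ 0 := by omega
    rw [zero_pow hb, mul_zero, zero_mul]
  · rw [zero_pow ha.ne', zero_mul, zero_mul]

/-- If `x₀^a x₁^b · V` has zero constant coefficient and `V(0) ≠ 0` then `a + b ≥ 1`. -/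
theorem one_le_add_of_constantCoeff_eq_zero {a b : ℕ} {V : MvPowerSeries (Fin 2) k} (hV : constantCoeff V ≠ 0)
    (h : constantCoeff (X 0 ^ a * X 1 ^ b * V) = 0) : 1 ≤ a + b := by
  by_contra hab
  obtain ⟨rfl, rfl⟩ : a = 0 ∧ b = 0 := by omega
  rw [pow_zero, pow_zero, one_mul, one_mul] at h
  exact hV h

/-! ### (M1) the monomial case `J₂ = (A₀)` -/

/-- (M1) THE SEPARABLE MONOMIAL CASE: `y² + x₀^r x₁^s·U + x₀^{⌊r/2⌋} x₁^{⌊s/2⌋}·B·y`, `U(0) ≠ 0`, `(r, s)` not both even, is won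
(characteristic `2`, `k = k̄`; given the singular one-variable germs).  Induction on `r + s` along the curve steps. -/
theorem sepMonomialWon [CharP k 2] [IsAlgClosed k]
    (hlow : ∀ g : MvPowerSeries (Fin 1) k, CobordantGame.IsSingular k g → CobordantGame.Won k 1 g) :
    ∀ (N r s : ℕ) (U B : MvPowerSeries (Fin 2) k), r + s ≤ N → constantCoeff U ≠ 0 → ¬ (2 ∣ r ∧ 2 ∣ s) →
      CobordantGame.Won k 3 (X (Fin.last 2) ^ 2 + (rename (Fin.succAboveEmb (Fin.last 2)) (X 0 ^ r * X 1 ^ s * U) +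
        rename (Fin.succAboveEmb (Fin.last 2)) (X 0 ^ (r / 2) * X 1 ^ (s / 2) * B) * X (Fin.last 2))) := by
  intro N
  induction N with
  | zero =>
    intro r s U B hN _ hpar
    obtain ⟨hr, hs⟩ : r = 0 ∧ s = 0 := by omega
    subst hr
    subst hs
    exact absurd ⟨dvd_zero 2, dvd_zero 2⟩ hpar
  | succ N ih =>
    intro r s U B hN hU hpar
    by_cases hsing : CobordantGame.IsSingular k (X (Fin.last 2) ^ 2 +
        (rename (Fin.succAboveEmb (Fin.last 2)) (X 0 ^ r * X 1 ^ s * U) +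
          rename (Fin.succAboveEmb (Fin.last 2)) (X 0 ^ (r / 2) * X 1 ^ (s / 2) * B) * X (Fin.last 2)))
    swap
    · exact (wonBy_zero_of_not_isSingular (by norm_num) hsing).won
    by_cases hlin : ∃ l : Fin 2, coeff (Finsupp.single l 1) (X 0 ^ (r / 2) * X 1 ^ (s / 2) * B) ≠ 0
    · obtain ⟨l, hl⟩ := hlin
      exact won_dp1_of_coeff_single_A₁_ne_zero hlow hsing l hl
    push Not at hlin
    by_cases hr : 2 ≤ r
    · -- blow up `V(x₀, y)`
      obtain ⟨r', rfl⟩ : ∃ r', r = r' + 2 := ⟨r - 2, by omega⟩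
      have hpar' : ¬ (2 ∣ r' ∧ 2 ∣ s) := fun h => hpar ⟨dvd_add h.1 (dvd_refl 2), h.2⟩
      have hdiv2 : (r' + 2) / 2 = r' / 2 + 1 := Nat.add_div_right r' two_pos
      rw [hdiv2] at hlin ⊢
      refine won_dp1_of_curveStep 2 Nat.prime_two k 0 _ _ (X 0 ^ r' * X 1 ^ s * U) (X 0 ^ (r' / 2) * X 1 ^ (s / 2) * B)
        (by ring) (by ring) ?_ ?_ ?_
      · have h1 := one_le_add_of_not_both_even hpar
        exact constantCoeff_monomial_mul_eq_zero h1 U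
      · rw [← coeff_single_X_mul 0, show X 0 * (X 0 ^ (r' / 2) * X 1 ^ (s / 2) * B) =
          X 0 ^ (r' / 2 + 1) * X 1 ^ (s / 2) * B by ring]
        exact hlin 0
      · intro c hc _
        rw [subst_rho_zero_unitMonomial, subst_rho_zero_unitMonomial,
          show C (c ^ 2) * (X 0 ^ r' * X 1 ^ s * (C (c ^ r') *
              subst (fun l : Fin 2 => if l = 0 then C c * X 0 else (X 1 : MvPowerSeries (Fin 2) k)) U)) =
            X 0 ^ r' * X 1 ^ s * (C (c ^ 2) * C (c ^ r') *
              subst (fun l : Fin 2 => if l = 0 then C c * X 0 else (X 1 : MvPowerSeries (Fin 2) k)) U) by ring,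
          show C c * (X 0 ^ (r' / 2) * X 1 ^ (s / 2) * (C (c ^ (r' / 2)) *
              subst (fun l : Fin 2 => if l = 0 then C c * X 0 else (X 1 : MvPowerSeries (Fin 2) k)) B)) =
            X 0 ^ (r' / 2) * X 1 ^ (s / 2) * (C c * C (c ^ (r' / 2)) *
              subst (fun l : Fin 2 => if l = 0 then C c * X 0 else (X 1 : MvPowerSeries (Fin 2) k)) B) by ring]
        refine ih r' s _ _ (by omega) ?_ hpar'
        rw [map_mul, map_mul, constantCoeff_C, constantCoeff_C, constantCoeff_subst_rho]
        exact mul_ne_zero (mul_ne_zero (pow_ne_zero _ hc) (pow_ne_zero _ hc)) hU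
    · by_cases hs : 2 ≤ s
      · -- blow up `V(x₁, y)`
        obtain ⟨s', rfl⟩ : ∃ s', s = s' + 2 := ⟨s - 2, by omega⟩
        have hpar' : ¬ (2 ∣ s' ∧ 2 ∣ r) := fun h => hpar ⟨h.2, dvd_add h.1 (dvd_refl 2)⟩
        have hdiv2 : (s' + 2) / 2 = s' / 2 + 1 := Nat.add_div_right s' two_pos
        rw [hdiv2] at hlin ⊢
        refine won_dp1_of_curveStep 2 Nat.prime_two k 1 _ _ (X 0 ^ r * X 1 ^ s' * U) (X 0 ^ (r / 2) * X 1 ^ (s' / 2) * B)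
          (by ring) (by ring) ?_ ?_ ?_
        · have h1 : 1 ≤ r + s' := by
            have := one_le_add_of_not_both_even (r := s') (s := r) (fun h => hpar ⟨h.2, h.1⟩)
            omega
          exact constantCoeff_monomial_mul_eq_zero h1 U
        · rw [← coeff_single_X_mul 1, show X 1 * (X 0 ^ (r / 2) * X 1 ^ (s' / 2) * B) =
            X 0 ^ (r / 2) * X 1 ^ (s' / 2 + 1) * B by ring]
          exact hlin 1
        · intro c hc _
          rw [subst_rho_one_unitMonomial, subst_rho_one_unitMonomial,
            show C (c ^ 2) * (X 0 ^ s' * X 1 ^ r * (C (c ^ s') *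
                subst (fun l : Fin 2 => if l = 1 then C c * X 0 else (X 1 : MvPowerSeries (Fin 2) k)) U)) =
              X 0 ^ s' * X 1 ^ r * (C (c ^ 2) * C (c ^ s') *
                subst (fun l : Fin 2 => if l = 1 then C c * X 0 else (X 1 : MvPowerSeries (Fin 2) k)) U) by ring,
            show C c * (X 0 ^ (s' / 2) * X 1 ^ (r / 2) * (C (c ^ (s' / 2)) *
                subst (fun l : Fin 2 => if l = 1 then C c * X 0 else (X 1 : MvPowerSeries (Fin 2) k)) B)) =
              X 0 ^ (s' / 2) * X 1 ^ (r / 2) * (C c * C (c ^ (s' / 2)) *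
                subst (fun l : Fin 2 => if l = 1 then C c * X 0 else (X 1 : MvPowerSeries (Fin 2) k)) B) by ring]
          refine ih s' r _ _ (by omega) ?_ hpar'
          rw [map_mul, map_mul, constantCoeff_C, constantCoeff_C, constantCoeff_subst_rho]
          exact mul_ne_zero (mul_ne_zero (pow_ne_zero _ hc) (pow_ne_zero _ hc)) hU
      · -- the bottom: `r, s ≤ 1`
        have hr1 : r ≤ 1 := by omega
        have hs1 : s ≤ 1 := by omega
        rw [Nat.div_eq_of_lt (by omega : r < 2), Nat.div_eq_of_lt (by omega : s < 2)] at hsing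
        rw [Nat.div_eq_of_lt (by omega : r < 2), Nat.div_eq_of_lt (by omega : s < 2)]
        interval_cases r <;> interval_cases s
        · exact absurd ⟨dvd_zero 2, dvd_zero 2⟩ hpar
        · refine absurd hsing (not_isSingular_dp1_of_coeff_single_ne_zero 1 ?_)
          have h := coeff_unitMonomial_self (k := k) 0 1 U
          rw [Finsupp.single_zero, zero_add] at h
          rw [h]; exact hU
        · refine absurd hsing (not_isSingular_dp1_of_coeff_single_ne_zero 0 ?_)
          have h := coeff_unitMonomial_self (k := k) 1 0 U
          rw [Finsupp.single_zero, add_zero] at h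
          rw [h]; exact hU
        · refine won_dp1_of_coeff_cross_A₀_ne_zero hlow hsing ?_
          rw [coeff_unitMonomial_self]; exact hU

/-! ### (M2) the two-sheets case `J₂ = (A₁²)` -/

/-- (M2) THE TWO-SHEETS CASE: `y² + x₀^{2r} x₁^{2s}·W + x₀^r x₁^s·V·y`, `V(0) ≠ 0`, is won (characteristic `2`, `k = k̄`; given the
singular one-variable germs).  Induction on `r + s` along the curve steps; bottom `r + s = 1` by the cross term `V(0)·x_i y`. -/
theorem sepSheetsWon [CharP k 2] [IsAlgClosed k]
    (hlow : ∀ g : MvPowerSeries (Fin 1) k, CobordantGame.IsSingular k g → CobordantGame.Won k 1 g) :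
    ∀ (N r s : ℕ) (V W : MvPowerSeries (Fin 2) k), r + s ≤ N → constantCoeff V ≠ 0 →
      CobordantGame.Won k 3 (X (Fin.last 2) ^ 2 + (rename (Fin.succAboveEmb (Fin.last 2)) (X 0 ^ (2 * r) * X 1 ^ (2 * s) * W) +
        rename (Fin.succAboveEmb (Fin.last 2)) (X 0 ^ r * X 1 ^ s * V) * X (Fin.last 2))) := by
  intro N
  induction N with
  | zero =>
    intro r s V W hN hV
    obtain ⟨hr, hs⟩ : r = 0 ∧ s = 0 := by omega
    subst hr
    subst hs
    refine (wonBy_zero_of_not_isSingular (by norm_num) (not_isSingular_dp1_of_constantCoeff_ne_zero ?_)).won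
    rw [pow_zero, pow_zero, one_mul, one_mul]; exact hV
  | succ N ih =>
    intro r s V W hN hV
    by_cases hsing : CobordantGame.IsSingular k (X (Fin.last 2) ^ 2 +
        (rename (Fin.succAboveEmb (Fin.last 2)) (X 0 ^ (2 * r) * X 1 ^ (2 * s) * W) +
          rename (Fin.succAboveEmb (Fin.last 2)) (X 0 ^ r * X 1 ^ s * V) * X (Fin.last 2)))
    swap
    · exact (wonBy_zero_of_not_isSingular (by norm_num) hsing).won
    by_cases hlin : ∃ l : Fin 2, coeff (Finsupp.single l 1) (X 0 ^ r * X 1 ^ s * V) ≠ 0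
    · obtain ⟨l, hl⟩ := hlin
      exact won_dp1_of_coeff_single_A₁_ne_zero hlow hsing l hl
    push Not at hlin
    have hA₁0 : constantCoeff (X 0 ^ r * X 1 ^ s * V) = 0 := by
      rw [← coeff_single_last_dp1 (X 0 ^ (2 * r) * X 1 ^ (2 * s) * W)]; exact hsing.2.2 _
    have hrs := one_le_add_of_constantCoeff_eq_zero hV hA₁0
    by_cases hr : 1 ≤ r
    · -- blow up `V(x₀, y)`
      obtain ⟨r', rfl⟩ : ∃ r', r = r' + 1 := ⟨r - 1, by omega⟩
      have h1 : constantCoeff (X 0 ^ r' * X 1 ^ s * V) = 0 := by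
        rw [← coeff_single_X_mul 0, show X 0 * (X 0 ^ r' * X 1 ^ s * V) = X 0 ^ (r' + 1) * X 1 ^ s * V by ring]
        exact hlin 0
      have hrs' := one_le_add_of_constantCoeff_eq_zero hV h1
      refine won_dp1_of_curveStep 2 Nat.prime_two k 0 _ _ (X 0 ^ (2 * r') * X 1 ^ (2 * s) * W) (X 0 ^ r' * X 1 ^ s * V)
        (by ring) (by ring) (constantCoeff_monomial_mul_eq_zero (by omega) W) h1 ?_
      intro c hc _
      rw [subst_rho_zero_unitMonomial, subst_rho_zero_unitMonomial,
        show C (c ^ 2) * (X 0 ^ (2 * r') * X 1 ^ (2 * s) * (C (c ^ (2 * r')) *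
            subst (fun l : Fin 2 => if l = 0 then C c * X 0 else (X 1 : MvPowerSeries (Fin 2) k)) W)) =
          X 0 ^ (2 * r') * X 1 ^ (2 * s) * (C (c ^ 2) * C (c ^ (2 * r')) *
            subst (fun l : Fin 2 => if l = 0 then C c * X 0 else (X 1 : MvPowerSeries (Fin 2) k)) W) by ring,
        show C c * (X 0 ^ r' * X 1 ^ s * (C (c ^ r') *
            subst (fun l : Fin 2 => if l = 0 then C c * X 0 else (X 1 : MvPowerSeries (Fin 2) k)) V)) =
          X 0 ^ r' * X 1 ^ s * (C c * C (c ^ r') *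
            subst (fun l : Fin 2 => if l = 0 then C c * X 0 else (X 1 : MvPowerSeries (Fin 2) k)) V) by ring]
      refine ih r' s _ _ (by omega) ?_
      rw [map_mul, map_mul, constantCoeff_C, constantCoeff_C, constantCoeff_subst_rho]
      exact mul_ne_zero (mul_ne_zero hc (pow_ne_zero _ hc)) hV
    · -- `r = 0`, `s ≥ 1`: blow up `V(x₁, y)`
      have hr0 : r = 0 := by omega
      subst hr0
      obtain ⟨s', rfl⟩ : ∃ s', s = s' + 1 := ⟨s - 1, by omega⟩
      have h1 : constantCoeff (X 0 ^ 0 * X 1 ^ s' * V) = 0 := by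
        rw [← coeff_single_X_mul 1, show X 1 * (X 0 ^ 0 * X 1 ^ s' * V) = X 0 ^ 0 * X 1 ^ (s' + 1) * V by ring]
        exact hlin 1
      have hrs' := one_le_add_of_constantCoeff_eq_zero hV h1
      refine won_dp1_of_curveStep 2 Nat.prime_two k 1 _ _ (X 0 ^ (2 * 0) * X 1 ^ (2 * s') * W) (X 0 ^ 0 * X 1 ^ s' * V)
        (by ring) (by ring) (constantCoeff_monomial_mul_eq_zero (by omega) W) h1 ?_
      intro c hc _
      rw [subst_rho_one_unitMonomial, subst_rho_one_unitMonomial,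
        show C (c ^ 2) * (X 0 ^ (2 * s') * X 1 ^ (2 * 0) * (C (c ^ (2 * s')) *
            subst (fun l : Fin 2 => if l = 1 then C c * X 0 else (X 1 : MvPowerSeries (Fin 2) k)) W)) =
          X 0 ^ (2 * s') * X 1 ^ (2 * 0) * (C (c ^ 2) * C (c ^ (2 * s')) *
            subst (fun l : Fin 2 => if l = 1 then C c * X 0 else (X 1 : MvPowerSeries (Fin 2) k)) W) by ring,
        show C c * (X 0 ^ s' * X 1 ^ 0 * (C (c ^ s') *
            subst (fun l : Fin 2 => if l = 1 then C c * X 0 else (X 1 : MvPowerSeries (Fin 2) k)) V)) =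
          X 0 ^ s' * X 1 ^ 0 * (C c * C (c ^ s') *
            subst (fun l : Fin 2 => if l = 1 then C c * X 0 else (X 1 : MvPowerSeries (Fin 2) k)) V) by ring]
      refine ih s' 0 _ _ (by omega) ?_
      rw [map_mul, map_mul, constantCoeff_C, constantCoeff_C, constantCoeff_subst_rho]
      exact mul_ne_zero (mul_ne_zero hc (pow_ne_zero _ hc)) hV

/-! ### (SR) the small residual case -/

/-- (SR) THE SEPARABLE SMALL RESIDUAL CASE: `y² + x_i^{2(m+1)}·g + x_i^{m+1}·B·y` with `g(0) = 0` and a non-zero linear coefficient of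
`g` is won (characteristic `2`, `k = k̄`; given the singular one-variable germs).  Induction on `m` along the curve steps at `V(x_i, y)`. -/
theorem sepSmallResidualWon [CharP k 2] [IsAlgClosed k]
    (hlow : ∀ g : MvPowerSeries (Fin 1) k, CobordantGame.IsSingular k g → CobordantGame.Won k 1 g) :
    ∀ (m : ℕ) (i : Fin 2) (g B : MvPowerSeries (Fin 2) k), constantCoeff g = 0 →
      (∃ l : Fin 2, coeff (Finsupp.single l 1) g ≠ 0) →
      CobordantGame.Won k 3 (X (Fin.last 2) ^ 2 + (rename (Fin.succAboveEmb (Fin.last 2)) (X i ^ (2 * (m + 1)) * g) +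
        rename (Fin.succAboveEmb (Fin.last 2)) (X i ^ (m + 1) * B) * X (Fin.last 2))) := by
  classical
  intro m
  induction m with
  | zero =>
    intro i g B hg0 hg1
    by_cases hsing : CobordantGame.IsSingular k (X (Fin.last 2) ^ 2 +
        (rename (Fin.succAboveEmb (Fin.last 2)) (X i ^ (2 * (0 + 1)) * g) +
          rename (Fin.succAboveEmb (Fin.last 2)) (X i ^ (0 + 1) * B) * X (Fin.last 2)))
    swap
    · exact (wonBy_zero_of_not_isSingular (by norm_num) hsing).won
    by_cases hlin : ∃ l : Fin 2, coeff (Finsupp.single l 1) (X i ^ (0 + 1) * B) ≠ 0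
    · obtain ⟨l, hl⟩ := hlin
      exact won_dp1_of_coeff_single_A₁_ne_zero hlow hsing l hl
    push Not at hlin
    obtain ⟨l, hl⟩ := hg1
    have h1 : constantCoeff B = 0 := by
      rw [← coeff_single_X_mul i, show X i * B = X i ^ (0 + 1) * B by ring]; exact hlin i
    refine won_dp1_of_curveStep 2 Nat.prime_two k i _ _ g B (by ring) (by ring) hg0 h1 fun c hc hS => ?_
    exfalso
    have hc2 : c ^ 2 ≠ 0 := pow_ne_zero _ hc
    by_cases hli : l = i
    · subst hli
      refine not_isSingular_dp1_of_coeff_single_ne_zero 0 ?_ hS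
      rw [coeff_C_mul, coeff_single_zero_subst_rho]
      exact mul_ne_zero hc2 (mul_ne_zero hc hl)
    · refine not_isSingular_dp1_of_coeff_single_ne_zero 1 ?_ hS
      rw [coeff_C_mul, coeff_single_one_subst_rho i l hli]
      exact mul_ne_zero hc2 hl
  | succ m ih =>
    intro i g B hg0 hg1
    by_cases hsing : CobordantGame.IsSingular k (X (Fin.last 2) ^ 2 +
        (rename (Fin.succAboveEmb (Fin.last 2)) (X i ^ (2 * (m + 1 + 1)) * g) +
          rename (Fin.succAboveEmb (Fin.last 2)) (X i ^ (m + 1 + 1) * B) * X (Fin.last 2)))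
    swap
    · exact (wonBy_zero_of_not_isSingular (by norm_num) hsing).won
    by_cases hlin : ∃ l : Fin 2, coeff (Finsupp.single l 1) (X i ^ (m + 1 + 1) * B) ≠ 0
    · obtain ⟨l, hl⟩ := hlin
      exact won_dp1_of_coeff_single_A₁_ne_zero hlow hsing l hl
    push Not at hlin
    obtain ⟨l, hl⟩ := hg1
    have h1 : constantCoeff (X i ^ (m + 1) * B) = 0 := by
      rw [← coeff_single_X_mul i, show X i * (X i ^ (m + 1) * B) = X i ^ (m + 1 + 1) * B by ring]; exact hlin i
    refine won_dp1_of_curveStep 2 Nat.prime_two k i _ _ (X i ^ (2 * (m + 1)) * g) (X i ^ (m + 1) * B)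
      (by ring) (by ring) (by rw [map_mul, hg0, mul_zero]) h1 fun c hc _ => ?_
    rw [subst_rho_X_pow_mul, subst_rho_X_pow_mul,
      show C (c ^ 2) * (X 0 ^ (2 * (m + 1)) * (C (c ^ (2 * (m + 1))) *
          subst (fun l : Fin 2 => if l = i then C c * X 0 else (X 1 : MvPowerSeries (Fin 2) k)) g)) =
        X 0 ^ (2 * (m + 1)) * (C (c ^ 2 * c ^ (2 * (m + 1))) *
          subst (fun l : Fin 2 => if l = i then C c * X 0 else (X 1 : MvPowerSeries (Fin 2) k)) g) by
        rw [map_mul]; ring,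
      show C c * (X 0 ^ (m + 1) * (C (c ^ (m + 1)) *
          subst (fun l : Fin 2 => if l = i then C c * X 0 else (X 1 : MvPowerSeries (Fin 2) k)) B)) =
        X 0 ^ (m + 1) * (C (c * c ^ (m + 1)) *
          subst (fun l : Fin 2 => if l = i then C c * X 0 else (X 1 : MvPowerSeries (Fin 2) k)) B) by
        rw [map_mul]; ring]
    have hcc : c ^ 2 * c ^ (2 * (m + 1)) ≠ 0 := mul_ne_zero (pow_ne_zero _ hc) (pow_ne_zero _ hc)
    refine ih 0 _ _ ?_ ?_
    · rw [map_mul, constantCoeff_C, constantCoeff_subst_rho, hg0, mul_zero]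
    · by_cases hli : l = i
      · subst hli
        refine ⟨0, ?_⟩
        rw [coeff_C_mul, coeff_single_zero_subst_rho]
        exact mul_ne_zero hcc (mul_ne_zero hc hl)
      · refine ⟨1, ?_⟩
        rw [coeff_C_mul, coeff_single_one_subst_rho i l hli]
        exact mul_ne_zero hcc hl

end SepTerminalDoublePoint

open SepTerminalDoublePoint TerminalDoublePoint MvPowerSeries in
/-- THE SEPARABLE TERMINAL DOUBLE POINTS ARE WON (characteristic `2`, `k = k̄`; only the singular germs in ONE variable are assumed
won): `y² + A₁(x₀,x₁)·y + A₀(x₀,x₁)` with `(A₀, A₁)` terminal — (M1) `A₀ = x₀^r x₁^s·U`, `U(0) ≠ 0`, `(r,s) ∉ 2ℕ²`,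
`A₁ = x₀^{⌊r/2⌋} x₁^{⌊s/2⌋}·B`; (M2) `A₁ = x₀^r x₁^s·V`, `V(0) ≠ 0`, `A₀ = x₀^{2r} x₁^{2s}·W`; (SR) `A₀ = x_i^{2m}·g`, `m ≥ 1`,
`ord g = 1`, `A₁ = x_i^m·B` — is won in the local weighted resolution game. [OURS · L1 W4.3] -/
theorem sepTerminalDoublePointWon (k : Type) [Field k] [CharP k 2] [IsAlgClosed k]
    (hlow : ∀ g : MvPowerSeries (Fin 1) k, CobordantGame.IsSingular k g → CobordantGame.Won k 1 g)
    (A₀ A₁ : MvPowerSeries (Fin 2) k)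
    (hT : (∃ (r s : ℕ) (U B : MvPowerSeries (Fin 2) k), MvPowerSeries.constantCoeff U ≠ 0 ∧ ¬ (2 ∣ r ∧ 2 ∣ s) ∧
            A₀ = MvPowerSeries.X (0 : Fin 2) ^ r * MvPowerSeries.X (1 : Fin 2) ^ s * U ∧
            A₁ = MvPowerSeries.X (0 : Fin 2) ^ (r / 2) * MvPowerSeries.X (1 : Fin 2) ^ (s / 2) * B) ∨
          (∃ (r s : ℕ) (V W : MvPowerSeries (Fin 2) k), MvPowerSeries.constantCoeff V ≠ 0 ∧
            A₁ = MvPowerSeries.X (0 : Fin 2) ^ r * MvPowerSeries.X (1 : Fin 2) ^ s * V ∧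
            A₀ = MvPowerSeries.X (0 : Fin 2) ^ (2 * r) * MvPowerSeries.X (1 : Fin 2) ^ (2 * s) * W) ∨
          (∃ (i : Fin 2) (m : ℕ) (g B : MvPowerSeries (Fin 2) k), 0 < m ∧ g.order = 1 ∧
            A₀ = MvPowerSeries.X i ^ (2 * m) * g ∧ A₁ = MvPowerSeries.X i ^ m * B)) :
    CobordantGame.Won k 3 (MvPowerSeries.X (Fin.last 2) ^ 2 +
      (MvPowerSeries.rename (Fin.succAboveEmb (Fin.last 2)) A₀ +
        MvPowerSeries.rename (Fin.succAboveEmb (Fin.last 2)) A₁ * MvPowerSeries.X (Fin.last 2))) := by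
  rcases hT with ⟨r, s, U, B, hU, hpar, rfl, rfl⟩ | ⟨r, s, V, W, hV, rfl, rfl⟩ | ⟨i, m, g, B, hm, hg, rfl, rfl⟩
  · exact sepMonomialWon hlow (r + s) r s U B le_rfl hU hpar
  · exact sepSheetsWon hlow (r + s) r s V W le_rfl hV
  · obtain ⟨m', rfl⟩ : ∃ m', m = m' + 1 := ⟨m - 1, by omega⟩
    obtain ⟨hg0, hg1⟩ := linear_of_order_eq_one hg
    exact sepSmallResidualWon hlow m' i g B hg0 hg1

/-- S2sT — THE TERMINAL SEPARABLE CHAR-2 DOUBLE POINTS ARE WON [OURS · L1 W4.3; the proposed v22 stub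
`stub_charTwoSeparableTerminalWon` of chain w43 BY NAME AND SIGNATURE (typed sub-cut of S2s, evidence #56 on stmt-8899); replaces the
role of the «monomial / small residual» terminal cases (Perlega 2017 §7.3 = Hauser–Perlega 2024 §3 p. 775, §8, at `c = p = 2`,
coefficient ideal `J₂ = (A₀, A₁²)`) of a surface-resolution algorithm; NOT a statement of any manuscript].  Over an algebraically closed
field of characteristic `2`, given the singular germs in `≤ 2` variables, the monic germ `y² + A₁(x₀,x₁)·y + A₀(x₀,x₁)`
(`ord A₀ ≥ 3`, `ord A₁ ≥ 2`, `A₁ ≠ 0`) is won whenever `(A₀, A₁)` is TERMINAL: (M1) `A₀ = x₀^r x₁^s·U`, `U(0) ≠ 0`, `(r,s) ∉ 2ℕ²`,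
`A₁ = x₀^{⌊r/2⌋} x₁^{⌊s/2⌋}·B`; or (M2) `A₁ = x₀^r x₁^s·V`, `V(0) ≠ 0`, `A₀ = x₀^{2r} x₁^{2s}·W`; or (SR) `A₀ = x_i^{2m}·g`, `m ≥ 1`,
`ord g = 1`, `A₁ = x_i^m·B`.  Proof: `sepTerminalDoublePointWon` (the hypotheses `ord A₀ ≥ 3`, `ord A₁ ≥ 2`, `A₁ ≠ 0` and the
two-variable germs are not needed). -/
theorem stub_charTwoSeparableTerminalWon : ∀ (k : Type) [Field k] [CharP k 2] [IsAlgClosed k],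
      (∀ m : ℕ, m < 3 → ∀ g : MvPowerSeries (Fin m) k,
        CobordantGame.IsSingular k g → CobordantGame.Won k m g) →
      ∀ (A₀ A₁ : MvPowerSeries (Fin 2) k), (2 : ℕ∞) < A₀.order → (1 : ℕ∞) < A₁.order → A₁ ≠ 0 →
        ((∃ (r s : ℕ) (U B : MvPowerSeries (Fin 2) k), MvPowerSeries.constantCoeff U ≠ 0 ∧ ¬ (2 ∣ r ∧ 2 ∣ s) ∧
            A₀ = MvPowerSeries.X (0 : Fin 2) ^ r * MvPowerSeries.X (1 : Fin 2) ^ s * U ∧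
            A₁ = MvPowerSeries.X (0 : Fin 2) ^ (r / 2) * MvPowerSeries.X (1 : Fin 2) ^ (s / 2) * B) ∨
          (∃ (r s : ℕ) (V W : MvPowerSeries (Fin 2) k), MvPowerSeries.constantCoeff V ≠ 0 ∧
            A₁ = MvPowerSeries.X (0 : Fin 2) ^ r * MvPowerSeries.X (1 : Fin 2) ^ s * V ∧
            A₀ = MvPowerSeries.X (0 : Fin 2) ^ (2 * r) * MvPowerSeries.X (1 : Fin 2) ^ (2 * s) * W) ∨
          (∃ (i : Fin 2) (m : ℕ) (g B : MvPowerSeries (Fin 2) k), 0 < m ∧ g.order = 1 ∧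
            A₀ = MvPowerSeries.X i ^ (2 * m) * g ∧ A₁ = MvPowerSeries.X i ^ m * B)) →
        CobordantGame.Won k 3 (MvPowerSeries.X (Fin.last 2) ^ 2 +
          (MvPowerSeries.rename (Fin.succAboveEmb (Fin.last 2)) A₀ +
            MvPowerSeries.rename (Fin.succAboveEmb (Fin.last 2)) A₁ * MvPowerSeries.X (Fin.last 2))) :=
  fun k _ _ _ hlow A₀ A₁ _ _ _ hT => sepTerminalDoublePointWon k (hlow 1 (by norm_num)) A₀ A₁ hT

end Summit.ResolutionOfSingularities.ResolutionOfSingularities.Theorems
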